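import Summits.RiemannHypothesis.RiemannHypothesis.Theorems.WeilGroundStateGroundStatesConvergeToXiRHofTight
import Summits.RiemannHypothesis.RiemannHypothesis.Theorems.WeilGroundStateGroundStatesConvergeToXiEnergyUpper
import Summits.RiemannHypothesis.RiemannHypothesis.Theorems.GronwallLeakage.Negative.LoadBearing
import Literature.NumberTheory.LFunctions.WeilExplicitFormulaProofs
import Literature.NumberTheory.LFunctions.WeilGroundEnergyProofs
import HarnessLib

/-!
# `WeilGroundState.GroundStatesConvergeToXi` — `RH ⟺ ε(a) → 0`; the dichotomy for Weil's ground energy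
(crux item stmt-RiemannHypothesis-1527, route route-RiemannHypothesis-WeilGroundState; line `Sketch`,
lead c2; `--supports`: energy side of the open stub `stub_tightWeakLimit`)

From the super-exponential upper bound `weilGroundEnergy_le_superexp` (RH-free, `…EnergyUpper.lean`),
`ε` antitone on `(0,∞)` and `RH ⟺ ε bounded below` (`riemannHypothesis_iff_weilGroundEnergy_bddBelow`):

* `weilGroundEnergy_eventually_le` — **`limsup_{a→∞} ε(a) ≤ 0` unconditionally** (for every `δ > 0`,
  `ε(a) ≤ δ` for all large `a`): Weil's form is never uniformly positive definite in `L²` on large windows.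
* `tendsto_weilGroundEnergy_zero_of_riemannHypothesis` — under RH, `0 ≤ ε(a) → 0`.
* `riemannHypothesis_iff_tendsto_weilGroundEnergy_zero` — **`RH ⟺ ε(a) → 0`**.
* `not_riemannHypothesis_iff_tendsto_weilGroundEnergy_atBot` — **`¬RH ⟺ ε(a) → −∞`**.
* `tendsto_weilGroundEnergy_zero_or_atBot` — the RH-free DICHOTOMY: `ε(a) → 0` or `ε(a) → −∞`.

For the crux: the limit energy in the Euler–Lagrange equation of any tight weak limit of renormalised
ground states is `ε_∞ = lim ε(a_k) ∈ {0, −∞}`; the crux's scenario (convergence to Riemann's kernel)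
lives entirely in the branch `ε_∞ = 0`, i.e. under RH, where the truncated kernel is a quasimode of
double-exponentially small energy.  No new definitions.
-/

noncomputable section

set_option linter.dupNamespace false

open scoped Topology Real
open Filter Set MeasureTheory Complex

namespace Summit.RiemannHypothesis.RiemannHypothesis.Theorems.GroundStatesConvergeToXi

open Literature.NumberTheory.LFunctions


/-- The super-exponential majorant tends to `0`: `C exp(−(π/2)e^{2(a−1)}) → 0` as `a → ∞`. [folklore] -/
theorem tendsto_superexpBound_zero (C : ℝ) :
    Tendsto (fun a : ℝ => C * Real.exp (-(π / 2 * Real.exp (2 * (a - 1))))) atTop (𝓝 0) := by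
  have h1 : Tendsto (fun a : ℝ => 2 * (a - 1)) atTop atTop :=
    (tendsto_atTop_add_const_right _ (-1) tendsto_id).const_mul_atTop two_pos |>.congr
      fun a => by simp only [id]; ring
  have h2 : Tendsto (fun a : ℝ => π / 2 * Real.exp (2 * (a - 1))) atTop atTop :=
    (Real.tendsto_exp_atTop.comp h1).const_mul_atTop (by positivity)
  have h3 : Tendsto (fun a : ℝ => Real.exp (-(π / 2 * Real.exp (2 * (a - 1))))) atTop (𝓝 0) :=
    Real.tendsto_exp_atBot.comp (tendsto_neg_atTop_atBot.comp h2)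
  simpa using h3.const_mul C

/-- **`limsup_{a→∞} ε(a) ≤ 0`, unconditionally**: for every `δ > 0`, `ε(a) ≤ δ` for all large `a`.
(Weil's form is never uniformly positive definite in `L²` on large windows.) [folklore] -/
theorem weilGroundEnergy_eventually_le {δ : ℝ} (hδ : 0 < δ) :
    ∀ᶠ a : ℝ in atTop, weilGroundEnergy a ≤ δ := by
  obtain ⟨C, -, hC⟩ := weilGroundEnergy_le_superexp
  filter_upwards [eventually_ge_atTop (2 : ℝ),
    (tendsto_superexpBound_zero C).eventually (ge_mem_nhds hδ)] with a ha hb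
  exact (hC a ha).trans hb

/-- **Under RH, `ε(a) → 0` as `a → ∞`** (`0 ≤ ε(a)` by Weil positivity, and the super-exponential
upper bound). [folklore] -/
theorem tendsto_weilGroundEnergy_zero_of_riemannHypothesis (hRH : RiemannHypothesis) :
    Tendsto weilGroundEnergy atTop (𝓝 0) := by
  obtain ⟨C, -, hC⟩ := weilGroundEnergy_le_superexp
  have hW : WeilPositivity := WeilPositivity.of_riemannHypothesis explicit_formula_holds hRH
  have hlow : ∀ a : ℝ, 0 < a → 0 ≤ weilGroundEnergy a := fun a ha =>
    (weilGroundEnergy_nonneg_iff_holds ha).2 fun g hg _ => hW g hg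
  refine tendsto_of_tendsto_of_tendsto_of_le_of_le' tendsto_const_nhds (tendsto_superexpBound_zero C)
    ?_ ?_
  · filter_upwards [eventually_gt_atTop (0 : ℝ)] with a ha using hlow a ha
  · filter_upwards [eventually_ge_atTop (2 : ℝ)] with a ha using hC a ha

/-- **RH ⟺ the ground energy tends to `0`**: `RiemannHypothesis ↔ ε(a) → 0` (`a → ∞`).
(`→`: previous theorem. `←`: a convergent `ε` is eventually `≥ -1`, and `ε` is non-increasing on
`(0,∞)`, so `ε` is bounded below; `riemannHypothesis_of_weilGroundEnergy_bddBelow`.)  Together with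
`riemannHypothesis_iff_weilGroundEnergy_bddBelow` this gives the dichotomy below. [folklore] -/
theorem riemannHypothesis_iff_tendsto_weilGroundEnergy_zero :
    RiemannHypothesis ↔ Tendsto weilGroundEnergy atTop (𝓝 0) := by
  refine ⟨tendsto_weilGroundEnergy_zero_of_riemannHypothesis, fun h => ?_⟩
  obtain ⟨a₀, ha₀⟩ := (h.eventually (le_mem_nhds (show (-1 : ℝ) < 0 by norm_num))).exists_forall_of_atTop
  refine riemannHypothesis_of_weilGroundEnergy_bddBelow ⟨min (-1) (weilGroundEnergy (max a₀ 1)), fun a ha => ?_⟩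
  rcases le_or_gt (max a₀ 1) a with h1 | h1
  · exact (min_le_left _ _).trans (ha₀ a ((le_max_left _ _).trans h1))
  · exact (min_le_right _ _).trans (Summit.RiemannHypothesis.Cruxes.GronwallLeakage.Negative.weilGroundEnergy_antitone_of_pos ha h1.le)

/-- **Failure of RH ⟺ the ground energy tends to `−∞`.** [folklore] -/
theorem not_riemannHypothesis_iff_tendsto_weilGroundEnergy_atBot :
    ¬ RiemannHypothesis ↔ Tendsto weilGroundEnergy atTop atBot := by
  constructor
  · intro hRH
    rw [riemannHypothesis_iff_weilGroundEnergy_bddBelow] at hRH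
    push Not at hRH
    refine tendsto_atBot.2 fun L => ?_
    obtain ⟨a, ha, hL⟩ := hRH L
    filter_upwards [eventually_ge_atTop a] with b hb
    exact (Summit.RiemannHypothesis.Cruxes.GronwallLeakage.Negative.weilGroundEnergy_antitone_of_pos ha hb).trans hL.le
  · intro h hRH
    obtain ⟨L, hL⟩ := riemannHypothesis_iff_weilGroundEnergy_bddBelow.1 hRH
    obtain ⟨a, ha⟩ := ((tendsto_atBot.1 h (L - 1)).and (eventually_gt_atTop 0)).exists
    linarith [hL a ha.2, ha.1]

/-- **Dichotomy for Weil's ground energy (RH-free)**: as the window grows, `ε(a)` either tends to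
`0` (iff RH) or to `−∞` (iff ¬RH); no other behaviour is possible. [folklore] -/
theorem tendsto_weilGroundEnergy_zero_or_atBot :
    Tendsto weilGroundEnergy atTop (𝓝 0) ∨ Tendsto weilGroundEnergy atTop atBot := by
  by_cases h : RiemannHypothesis
  · exact Or.inl (riemannHypothesis_iff_tendsto_weilGroundEnergy_zero.1 h)
  · exact Or.inr (not_riemannHypothesis_iff_tendsto_weilGroundEnergy_atBot.1 h)

end Summit.RiemannHypothesis.RiemannHypothesis.Theorems.GroundStatesConvergeToXi

end
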